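import Mathlib
import HarnessLib
import Summits.Ventures.LatticeQCDFlow.Exactness.ExactStepBoxMinorised
import Summits.Ventures.LatticeQCDFlow.Exactness.HaarConvolutionNearIdentity
import Summits.Ventures.LatticeQCDFlow.Exactness.MetropolisSweepErgodic

/-!
# A compact-group Metropolis sweep followed by ANY exact step converges from every start: the `'metro' + n_or × 'or'` composite, abstractly

HONEST FRAMING: exact (Metropolis-corrected) sampling algorithms for lattice gauge theory;
figures of merit are autocorrelation/cost numbers at stated couplings and volumes; no
continuum-physics claim.

Venture `LatticeQCDFlow` (cell pub-lqcd), topic `Exactness`, FANOUT row 9 (eng-latcore, the engine's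
`latflow.core.updates.composite_sweep(f, β, 'metro', n_or)`: one N-hit Metropolis sweep over all links,
then `n_or` over-relaxation sweeps).  NEW WORK of the cell over the tree (`ExactStepBoxMinorised.lean`: an
exact update dominating product Haar on a box around every configuration, composed with any exact Markov
kernel, converges from every start on a compact connected group lattice; `MetropolisSweepErgodic.lean`:
`metropolisSweep`, `metropolisSweep_minorised_walk`, `foldr_linkLaw_eq_pi`, `metropolisSweep_invariant`;
`PiGroupKicks.lean`: `mconvPow`; `GroupMetropolisLinkErgodic.lean`: `gibbsProbability`) and Mathlib
(`HaarConvolutionNearIdentity.lean`: convolution powers of a law dominating Haar near `1` dominate Haar near `1`).  Nothing is cited as a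
fact; no number is claimed.

THE POINT.  `MetropolisSweepErgodic.lean` needs the `(k+1)`-st power of the SWEEP ALONE (random-walk
structure); an over-relaxation sweep in between breaks that.  Here the sweep is shown to dominate product
Haar on a BOX around every configuration — one box shape, one constant — which is all
`ExactStepBoxMinorised.lean` asks; the interleaved step may be ANY Markov kernel leaving the Gibbs law
invariant.

* (compact group, links `ι`; the convolution lemmas are `HaarConvolutionNearIdentity.lean`) **`metropolisSweep_box_minorised`** — for a step law `ν ≥ a · Haar|_V`, a
  pinched measurable weight, `n ≥ 1` hits and a scan through every link, the sweep dominates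
  `κ · Haar^{⊗ι}|_{ {W : W_j U_j⁻¹ ∈ V'} }` from EVERY `U`, one open `V' ∋ 1` and one `κ ≠ 0` for all `U`;
  **`metropolisSweep_exactStep_uniformlyErgodic`** — `G` compact, connected, second countable,
  pseudo-metrisable; `ν` an inversion-invariant probability step law with `ν ≥ a · Haar|_V`; weight pinched
  `0 < m ≤ w ≤ M` and measurable; `n ≥ 1`; scan through every link; `P` ANY Markov kernel leaving
  `π = Z⁻¹ w · Haar^{⊗ι}` invariant.  Then `|μ₀ (P ∘ₖ S)ᵗ(A) − π(A)| ≤ (1 − ε)^{⌊t/(mm+1)⌋}` for some `mm`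
  and `ε ∈ (0, 1]`, EVERY initial law, every `t`, every `A` (`S` the sweep), and `π` is the unique
  invariant probability law of `P ∘ₖ S`; **`metropolisSweep_exactStep_uniformlyErgodic'`** — the same for
  `S ∘ₖ P`.

NOT CLAIMED: any value of `mm` or `ε`; the engine instances (`SU(N)` kick law + Cabibbo–Marinari OR
sweeps: `SUNMetropolisORSweepErgodic.lean`); floating point.
-/

noncomputable section

namespace Summit.Ventures.LatticeQCDFlow.Exactness

open MeasureTheory Measure Metric Set Filter Topology Function ProbabilityTheory ProbabilityTheory.Kernel
open Literature.MathematicalPhysics.QuantumFieldTheory (haarProbability)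
open scoped ENNReal Pointwise

/-! ## The Metropolis sweep dominates product Haar on a box; the composite converges -/

section Sweep

variable {ι : Type*} [Fintype ι] [DecidableEq ι] {G : Type*} [TopologicalSpace G] [Group G]
  [IsTopologicalGroup G] [CompactSpace G] [MeasurableSpace G] [BorelSpace G] [SecondCountableTopology G]
variable {ν : Measure G} [IsProbabilityMeasure ν] {w : (ι → G) → ℝ} {m M : ℝ}

/-- **THE SWEEP DOMINATES PRODUCT HAAR ON A BOX AROUND EVERY CONFIGURATION.**  For a step law
`ν ≥ a · Haar|_V` (`V ∈ 𝓝 1`, `a ≠ 0`), a measurable weight pinched `0 < m ≤ w ≤ M`, `n ≥ 1` hits per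
visit and a scan `L` through every link: there are an open `V' ∋ 1` and `κ ≠ 0` with
`κ · Haar^{⊗ι}|_{ {W : ∀ j, W_j U_j⁻¹ ∈ V'} } ≤ S(U, ·)` for EVERY `U`, `S = metropolisSweep ν w n L`. -/
theorem metropolisSweep_box_minorised {a : ℝ≥0∞} (ha : a ≠ 0) {V : Set G} (hV : V ∈ 𝓝 (1 : G))
    (hν : a • (haarProbability G).restrict V ≤ ν) (hw : Measurable w) (hm : 0 < m) (hwm : ∀ U, m ≤ w U)
    (hwM : ∀ U, w U ≤ M) {n : ℕ} (hn : 1 ≤ n) {L : List ι} (hL : ∀ j, j ∈ L) :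
    ∃ V' : Set G, IsOpen V' ∧ (1 : G) ∈ V' ∧ ∃ κ : ℝ≥0∞, κ ≠ 0 ∧ ∀ U : ι → G,
      κ • (Measure.pi fun _ : ι => haarProbability G).restrict {W | ∀ j, W j * (U j)⁻¹ ∈ V'} ≤
        metropolisSweep ν w n L U := by
  -- per link: the convolution power dominates Haar near `1`
  have hpow : ∀ j : ι, ∃ W : Set G, IsOpen W ∧ (1 : G) ∈ W ∧ ∃ c : ℝ≥0∞, c ≠ 0 ∧
      c • (haarProbability G).restrict W ≤ mconvPow ν (n * L.count j) := by
    intro j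
    have hc : 1 ≤ L.count j := List.count_pos_iff.2 (hL j)
    obtain ⟨e, he⟩ : ∃ e : ℕ, n * L.count j = e + 1 :=
      ⟨n * L.count j - 1, (Nat.sub_add_cancel (Nat.one_le_iff_ne_zero.2 (Nat.mul_ne_zero
        (Nat.one_le_iff_ne_zero.1 hn) (Nat.one_le_iff_ne_zero.1 hc)))).symm⟩
    rw [he]
    exact exists_smul_restrict_le_mconvPow (μ := haarProbability G) ha hV hν e
  choose W hWo hW1 c hc hle using hpow
  refine ⟨⋂ j, W j, isOpen_iInter_of_finite hWo, mem_iInter.2 hW1,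
    (ENNReal.ofReal (m / M) ^ n) ^ L.length * ∏ j, c j,
    mul_ne_zero (pow_ne_zero _ (pow_ne_zero _ ?_)) (Finset.prod_ne_zero_iff.2 fun j _ => hc j), fun U => ?_⟩
  · have hM : 0 < M := hm.trans_le ((hwm fun _ => 1).trans (hwM _))
    rw [Ne, ENNReal.ofReal_eq_zero, not_le]
    exact div_pos hm hM
  -- every coordinate law dominates Haar on the common box
  have hcoord : ∀ j, c j • (haarProbability G).restrict (⋂ i, W i) ≤ mconvPow ν (n * L.count j) := fun j =>
    calc c j • (haarProbability G).restrict (⋂ i, W i) ≤ c j • (haarProbability G).restrict (W j) := by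
          refine Measure.le_iff'.2 fun E => ?_
          simp only [Measure.smul_apply, smul_eq_mul]
          exact mul_le_mul' le_rfl (Measure.le_iff'.1 (Measure.restrict_mono (iInter_subset _ j) le_rfl) E)
      _ ≤ mconvPow ν (n * L.count j) := hle j
  haveI := sFinite_foldr_mconv (fun l : ι => mconvPow (ν.map (update (1 : ι → G) l)) n) L
  have hwalk := metropolisSweep_minorised_walk (ν := ν) hw hm hwm hwM n L U
  rw [foldr_linkLaw_eq_pi] at hwalk
  calc ((ENNReal.ofReal (m / M) ^ n) ^ L.length * ∏ j, c j) •
        (Measure.pi fun _ : ι => haarProbability G).restrict {W' | ∀ j, W' j * (U j)⁻¹ ∈ ⋂ i, W i}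
      = (ENNReal.ofReal (m / M) ^ n) ^ L.length • ((∏ j, c j) •
          (Measure.pi fun _ : ι => haarProbability G).restrict {W' | ∀ j, W' j * (U j)⁻¹ ∈ ⋂ i, W i}) := by
        rw [smul_smul]
    _ ≤ (ENNReal.ofReal (m / M) ^ n) ^ L.length • mulWalk (Measure.pi fun j => mconvPow ν (n * L.count j)) U := by
        refine Measure.le_iff'.2 fun E => ?_
        simp only [Measure.smul_apply, smul_eq_mul]
        exact mul_le_mul' le_rfl
          (Measure.le_iff'.1 (smul_restrict_box_le_mulWalk_pi (μH := haarProbability G) hcoord U) E)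
    _ ≤ metropolisSweep ν w n L U := hwalk

variable [TopologicalSpace.PseudoMetrizableSpace G] [ConnectedSpace G] [ν.IsInvInvariant]

/-- **THE METROPOLIS SWEEP FOLLOWED BY ANY EXACT STEP CONVERGES FROM EVERY START, AT EVERY TIME, AND
HAS THE GIBBS LAW AS ITS ONLY INVARIANT LAW.**  `G` a compact connected second-countable
pseudo-metrisable group; `ν` an inversion-invariant probability step law dominating `a · Haar|_V`
(`V ∈ 𝓝 1`, `a ≠ 0`); a measurable weight pinched `0 < m ≤ w ≤ M`; `n ≥ 1` hits per visit; a scan `L`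
through every link; `P` ANY Markov kernel leaving `π = Z⁻¹ w · Haar^{⊗ι}` invariant (an over-relaxation
sweep, or anything exact).  Then for some `mm` and `ε ∈ (0, 1]`:
`|μ₀ (P ∘ₖ S)ᵗ(A) − π(A)| ≤ (1 − ε)^{⌊t/(mm+1)⌋}` for EVERY initial law `μ₀`, every `t`, every `A`, where
`S = metropolisSweep ν w n L` ("sweep, then `P`"); and `π` is the unique invariant probability law. -/
theorem metropolisSweep_exactStep_uniformlyErgodic {a : ℝ≥0∞} (ha : a ≠ 0) {V : Set G} (hV : V ∈ 𝓝 (1 : G))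
    (hν : a • (haarProbability G).restrict V ≤ ν) (hw : Measurable w) (hm : 0 < m) (hwm : ∀ U, m ≤ w U)
    (hwM : ∀ U, w U ≤ M) {n : ℕ} (hn : 1 ≤ n) {L : List ι} (hL : ∀ j, j ∈ L)
    (P : Kernel (ι → G) (ι → G)) [IsMarkovKernel P]
    (hP : Invariant P (gibbsProbability (Measure.pi fun _ : ι => haarProbability G) w)) :
    ∃ mm : ℕ, ∃ ε : ℝ, 0 < ε ∧ ε ≤ 1 ∧
      (∀ (μ₀ : Measure (ι → G)) [IsProbabilityMeasure μ₀] (t : ℕ) (A : Set (ι → G)),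
        |((fun ν' : Measure (ι → G) => ν'.bind (P ∘ₖ metropolisSweep ν w n L))^[t] μ₀).real A
            - (gibbsProbability (Measure.pi fun _ : ι => haarProbability G) w).real A| ≤ (1 - ε) ^ (t / (mm + 1))) ∧
      ∀ (π' : Measure (ι → G)) [IsProbabilityMeasure π'],
        Invariant (P ∘ₖ metropolisSweep ν w n L) π' →
          π' = gibbsProbability (Measure.pi fun _ : ι => haarProbability G) w := by
  obtain ⟨V', hV'o, hV'1, κ, hκ, hbox⟩ := metropolisSweep_box_minorised ha hV hν hw hm hwm hwM hn hL
  haveI := isMarkovKernel_metropolisSweep ν hw n L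
  have hw0 : ∀ U, 0 < w U := fun U => hm.trans_le (hwm U)
  exact exactStep_uniformlyErgodic_of_box_minorised hm hwm hwM
    (invariant_gibbsProbability (metropolisSweep_invariant ν hw hw0 n L)) hV'o hV'1 hκ hbox P hP

/-- **ANY EXACT STEP FOLLOWED BY THE METROPOLIS SWEEP CONVERGES FROM EVERY START TOO**:
`|μ₀ (S ∘ₖ P)ᵗ(A) − π(A)| ≤ (1 − ε)^{⌊t/(mm+1)⌋}` and `π` is the unique invariant probability law of
`S ∘ₖ P` ("`P`, then the sweep"). -/
theorem metropolisSweep_exactStep_uniformlyErgodic' {a : ℝ≥0∞} (ha : a ≠ 0) {V : Set G}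
    (hV : V ∈ 𝓝 (1 : G)) (hν : a • (haarProbability G).restrict V ≤ ν) (hw : Measurable w) (hm : 0 < m)
    (hwm : ∀ U, m ≤ w U) (hwM : ∀ U, w U ≤ M) {n : ℕ} (hn : 1 ≤ n) {L : List ι} (hL : ∀ j, j ∈ L)
    (P : Kernel (ι → G) (ι → G)) [IsMarkovKernel P]
    (hP : Invariant P (gibbsProbability (Measure.pi fun _ : ι => haarProbability G) w)) :
    ∃ mm : ℕ, ∃ ε : ℝ, 0 < ε ∧ ε ≤ 1 ∧
      (∀ (μ₀ : Measure (ι → G)) [IsProbabilityMeasure μ₀] (t : ℕ) (A : Set (ι → G)),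
        |((fun ν' : Measure (ι → G) => ν'.bind (metropolisSweep ν w n L ∘ₖ P))^[t] μ₀).real A
            - (gibbsProbability (Measure.pi fun _ : ι => haarProbability G) w).real A| ≤ (1 - ε) ^ (t / (mm + 1))) ∧
      ∀ (π' : Measure (ι → G)) [IsProbabilityMeasure π'],
        Invariant (metropolisSweep ν w n L ∘ₖ P) π' →
          π' = gibbsProbability (Measure.pi fun _ : ι => haarProbability G) w := by
  obtain ⟨V', hV'o, hV'1, κ, hκ, hbox⟩ := metropolisSweep_box_minorised ha hV hν hw hm hwm hwM hn hL
  haveI := isMarkovKernel_metropolisSweep ν hw n L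
  have hw0 : ∀ U, 0 < w U := fun U => hm.trans_le (hwm U)
  exact exactStep_uniformlyErgodic_of_box_minorised' hm hwm hwM
    (invariant_gibbsProbability (metropolisSweep_invariant ν hw hw0 n L)) hV'o hV'1 hκ hbox P hP

end Sweep

/-! ## §2 The Doeblin power behind the composite, stated; exact steps on BOTH sides of the sweep

(Appended, gen-22.)  The convergence theorems of §1 rest on a Doeblin POWER of the composite that their
statements hide.  Here it is exposed — **`metropolisSweep_exactStep_nHit_minorised`**:
`a' • π ≤ (P ∘ₖ S)^{mm+1}(U, ·)` for EVERY configuration `U` (and the primed form for `S ∘ₖ P`) — which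
is exactly the hypothesis `∀ x, ε • ν ≤ κ x` under which the tree's Doeblin files
(`DoeblinAutocovariance`, `DoeblinTauInt`, `DoeblinObservables`, `DoeblinUniqueness`,
`MetropolisSweepConvergence`) run, applied to the `(mm+1)`-skeleton `κ = (P ∘ₖ S)^{mm+1}` of the composite.
And the composite is read at ANY PHASE of its cycle: with exact steps before AND after the sweep —
`P₂ ∘ₖ S ∘ₖ P₁`, i.e. over-relaxation sweeps on both sides of the Metropolis sweep, or the periodic chain
`…, S, P, P, S, P, P, …` observed after the first `P` of each period — the chain converges from every start
at every time and the Gibbs law is its only invariant probability law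
(**`twoSided_uniformlyErgodic`** on any compact preconnected space for a locally spreading exact `S`;
**`metropolisSweep_twoSided_uniformlyErgodic`** for the compact-group sweep).  Over
`SpreadingKernelDoeblin.exists_nHit_comp_minorised(')`, `RefreshScan.minorised_comp_left/right`,
`MetropolisSweepConvergence.uniformlyErgodic_of_nHit_minorised`, `DoeblinUniqueness.invariant_unique_of_minorised`;
no number is claimed (`mm`, `a'` come from compactness and connectedness). -/

section TwoSidedAlgebra

variable {α : Type*} [MeasurableSpace α]

/-- Powers of a two-sided composite, reassociated (kernel composition, rightmost kernel first):
`(P₂ S P₁)^{j+1} = (P₂ S) ∘ ((P₁ P₂) S)^j ∘ P₁`. -/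
theorem nHit_twoSided_succ (S P₁ P₂ : Kernel α α) :
    ∀ j : ℕ, nHit (P₂ ∘ₖ (S ∘ₖ P₁)) (j + 1) = (P₂ ∘ₖ S) ∘ₖ (nHit ((P₁ ∘ₖ P₂) ∘ₖ S) j ∘ₖ P₁)
  | 0 => by
      rw [nHit_succ]
      simp only [nHit_zero, Kernel.comp_id, Kernel.id_comp, Kernel.comp_assoc]
  | j + 1 => by
      rw [nHit_succ, nHit_twoSided_succ S P₁ P₂ j, nHit_succ]
      simp only [Kernel.comp_assoc]

end TwoSidedAlgebra

section TwoSided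

variable {X : Type*} [PseudoMetricSpace X] [MeasurableSpace X] [BorelSpace X] [SecondCountableTopology X]
  [CompactSpace X] [PreconnectedSpace X] {π : Measure X} [IsProbabilityMeasure π]
  {S P₁ P₂ : Kernel X X} [IsMarkovKernel S] [IsMarkovKernel P₁] [IsMarkovKernel P₂] {c : ℝ≥0∞} {r : ℝ}

omit [IsMarkovKernel S] in
/-- **A POWER OF THE TWO-SIDED COMPOSITE `P₂ ∘ₖ S ∘ₖ P₁` IS DOEBLIN.**  On a compact preconnected space
with a probability law `π` charging every ball: if the kernel `S` leaves `π` invariant and spreads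
locally (`S(y, ·) ≥ c · π|_{B(y, r)}` for all `y`, `c ≠ 0`, `r > 0`) and `P₁`, `P₂` are ANY Markov kernels
leaving `π` invariant, then `a • π ≤ (P₂ ∘ₖ S ∘ₖ P₁)^{m+2} x` for EVERY `x`, for some `m` and `a ≠ 0`
(first `P₁`, then `((P₁P₂) S)^{m+1}` is Doeblin from every point by `exists_nHit_comp_minorised`, then `S`
and `P₂` preserve `π`). -/
theorem exists_nHit_twoSided_minorised (hS : Invariant S π) (hP₁ : Invariant P₁ π) (hP₂ : Invariant P₂ π)
    (hr : 0 < r) (hc : c ≠ 0) (hK : ∀ y, c • π.restrict (ball y r) ≤ S y)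
    (hpos : ∀ (x : X) (ρ : ℝ), 0 < ρ → π (ball x ρ) ≠ 0) :
    ∃ m : ℕ, ∃ a : ℝ≥0∞, a ≠ 0 ∧ ∀ x, a • π ≤ nHit (P₂ ∘ₖ (S ∘ₖ P₁)) (m + 2) x := by
  obtain ⟨m, a, ha, hmin⟩ :=
    exists_nHit_comp_minorised (K := S) (P := P₁ ∘ₖ P₂) (hP₁.comp hP₂) hr hc hK hpos
  refine ⟨m, a, ha, fun x => ?_⟩
  rw [nHit_twoSided_succ S P₁ P₂ (m + 1)]
  have h1 : ∀ y, a • π ≤ (nHit ((P₁ ∘ₖ P₂) ∘ₖ S) (m + 1) ∘ₖ P₁) y := minorised_comp_right hmin P₁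
  have h2 := minorised_comp_left h1 (P₂ ∘ₖ S) x
  rwa [(hP₂.comp hS).def] at h2

/-- **THE TWO-SIDED COMPOSITE CONVERGES FROM EVERY START, AT EVERY TIME, AND HAS `π` AS ITS ONLY INVARIANT
LAW**: under the hypotheses of `exists_nHit_twoSided_minorised` there are `m` and `ε ∈ (0, 1]` with
`|μ₀ (P₂ ∘ₖ S ∘ₖ P₁)ᵗ(A) − π(A)| ≤ (1 − ε)^{⌊t/(m+1)⌋}` for EVERY initial law `μ₀`, every `t`, every `A`,
and every invariant probability law of `P₂ ∘ₖ S ∘ₖ P₁` is `π`. -/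
theorem twoSided_uniformlyErgodic (hS : Invariant S π) (hP₁ : Invariant P₁ π) (hP₂ : Invariant P₂ π)
    (hr : 0 < r) (hc : c ≠ 0) (hK : ∀ y, c • π.restrict (ball y r) ≤ S y)
    (hpos : ∀ (x : X) (ρ : ℝ), 0 < ρ → π (ball x ρ) ≠ 0) :
    ∃ m : ℕ, ∃ ε : ℝ, 0 < ε ∧ ε ≤ 1 ∧
      (∀ (μ₀ : Measure X) [IsProbabilityMeasure μ₀] (t : ℕ) (A : Set X),
        |((fun ν : Measure X => ν.bind (P₂ ∘ₖ (S ∘ₖ P₁)))^[t] μ₀).real A - π.real A|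
          ≤ (1 - ε) ^ (t / (m + 1))) ∧
      ∀ (π' : Measure X) [IsProbabilityMeasure π'], Invariant (P₂ ∘ₖ (S ∘ₖ P₁)) π' → π' = π := by
  obtain ⟨m, a, ha0, hmin⟩ := exists_nHit_twoSided_minorised hS hP₁ hP₂ hr hc hK hpos
  obtain ⟨x₀⟩ := nonempty_of_isProbabilityMeasure π
  have hinv : Invariant (P₂ ∘ₖ (S ∘ₖ P₁)) π := hP₂.comp (hS.comp hP₁)
  haveI : IsMarkovKernel (nHit (P₂ ∘ₖ (S ∘ₖ P₁)) (m + 1 + 1)) := isMarkovKernel_nHit _ _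
  have ha1 : a ≤ 1 := by
    have h := Measure.le_iff'.1 (hmin x₀) univ
    rwa [Measure.smul_apply, smul_eq_mul, measure_univ, measure_univ, mul_one] at h
  have hatop : a ≠ ⊤ := ne_top_of_le_ne_top ENNReal.one_ne_top ha1
  refine ⟨m + 1, a.toReal, ENNReal.toReal_pos ha0 hatop, ENNReal.toReal_le_of_le_ofReal zero_le_one
    (by rwa [ENNReal.ofReal_one]), fun μ₀ _ t A => uniformlyErgodic_of_nHit_minorised hmin hinv μ₀ t A,
    fun π' _ hπ' => ?_⟩
  exact invariant_unique_of_minorised (κ := nHit (P₂ ∘ₖ (S ∘ₖ P₁)) (m + 1 + 1)) hmin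
    (pos_iff_ne_zero.2 ha0) (invariant_nHit hinv _) (invariant_nHit hπ' _)

end TwoSided

section SweepPhase

variable {ι : Type*} [Fintype ι] [DecidableEq ι] {G : Type*} [TopologicalSpace G] [Group G]
  [IsTopologicalGroup G] [CompactSpace G] [MeasurableSpace G] [BorelSpace G] [SecondCountableTopology G]
  [TopologicalSpace.PseudoMetrizableSpace G] [ConnectedSpace G]
variable {ν : Measure G} [IsProbabilityMeasure ν] {w : (ι → G) → ℝ} {m M : ℝ}

/-- **THE DOEBLIN POWER OF "SWEEP, THEN ANY EXACT STEP", STATED.**  `G` compact connected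
second-countable pseudo-metrisable; step law `ν ≥ a · Haar|_V` (`V ∈ 𝓝 1`, `a ≠ 0`); weight measurable
and pinched `0 < m ≤ w ≤ M`; `n ≥ 1` hits; a scan `L` through every link; `P` ANY Markov kernel leaving
`π = Z⁻¹ w · Haar^{⊗ι}` invariant.  Then `a' • π ≤ (P ∘ₖ S)^{mm+1}(U, ·)` for EVERY `U`, for some `mm`
and `a' ≠ 0` (`S = metropolisSweep ν w n L`) — the minorisation every Doeblin consequence of the tree
consumes, for the `(mm+1)`-skeleton of the composite. -/
theorem metropolisSweep_exactStep_nHit_minorised {a : ℝ≥0∞} (ha : a ≠ 0) {V : Set G}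
    (hV : V ∈ 𝓝 (1 : G)) (hν : a • (haarProbability G).restrict V ≤ ν) (hw : Measurable w) (hm : 0 < m)
    (hwm : ∀ U, m ≤ w U) (hwM : ∀ U, w U ≤ M) {n : ℕ} (hn : 1 ≤ n) {L : List ι} (hL : ∀ j, j ∈ L)
    (P : Kernel (ι → G) (ι → G)) [IsMarkovKernel P]
    (hP : Invariant P (gibbsProbability (Measure.pi fun _ : ι => haarProbability G) w)) :
    ∃ mm : ℕ, ∃ a' : ℝ≥0∞, a' ≠ 0 ∧ ∀ U : ι → G,
      a' • gibbsProbability (Measure.pi fun _ : ι => haarProbability G) w ≤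
        nHit (P ∘ₖ metropolisSweep ν w n L) (mm + 1) U := by
  letI : PseudoMetricSpace G := TopologicalSpace.pseudoMetrizableSpacePseudoMetric G
  obtain ⟨V', hV'o, hV'1, κ, hκ, hbox⟩ := metropolisSweep_box_minorised ha hV hν hw hm hwm hwM hn hL
  obtain ⟨r, hr, c, hc, hK, hpos⟩ := spreads_of_box_minorised (ι := ι) hm hwm hwM hV'o hV'1 hκ hbox
  haveI := isProbabilityMeasure_gibbsProbability (μ := Measure.pi fun _ : ι => haarProbability G) hm hwm hwM
  exact exists_nHit_comp_minorised hP hr hc hK hpos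

variable [ν.IsInvInvariant]

/-- **THE DOEBLIN POWER OF "ANY EXACT STEP, THEN THE SWEEP"**: `a' • π ≤ (S ∘ₖ P)^{mm+2}(U, ·)` for EVERY
`U` (`ν` inversion-invariant, so that the sweep itself leaves `π` invariant). -/
theorem metropolisSweep_exactStep_nHit_minorised' {a : ℝ≥0∞} (ha : a ≠ 0) {V : Set G}
    (hV : V ∈ 𝓝 (1 : G)) (hν : a • (haarProbability G).restrict V ≤ ν) (hw : Measurable w) (hm : 0 < m)
    (hwm : ∀ U, m ≤ w U) (hwM : ∀ U, w U ≤ M) {n : ℕ} (hn : 1 ≤ n) {L : List ι} (hL : ∀ j, j ∈ L)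
    (P : Kernel (ι → G) (ι → G)) [IsMarkovKernel P]
    (hP : Invariant P (gibbsProbability (Measure.pi fun _ : ι => haarProbability G) w)) :
    ∃ mm : ℕ, ∃ a' : ℝ≥0∞, a' ≠ 0 ∧ ∀ U : ι → G,
      a' • gibbsProbability (Measure.pi fun _ : ι => haarProbability G) w ≤
        nHit (metropolisSweep ν w n L ∘ₖ P) (mm + 2) U := by
  letI : PseudoMetricSpace G := TopologicalSpace.pseudoMetrizableSpacePseudoMetric G
  obtain ⟨V', hV'o, hV'1, κ, hκ, hbox⟩ := metropolisSweep_box_minorised ha hV hν hw hm hwm hwM hn hL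
  obtain ⟨r, hr, c, hc, hK, hpos⟩ := spreads_of_box_minorised (ι := ι) hm hwm hwM hV'o hV'1 hκ hbox
  haveI := isProbabilityMeasure_gibbsProbability (μ := Measure.pi fun _ : ι => haarProbability G) hm hwm hwM
  haveI := isMarkovKernel_metropolisSweep ν hw n L
  have hw0 : ∀ U, 0 < w U := fun U => hm.trans_le (hwm U)
  exact exists_nHit_comp_minorised'
    (invariant_gibbsProbability (metropolisSweep_invariant ν hw hw0 n L)) hP hr hc hK hpos

/-- **EXACT STEPS BEFORE AND AFTER THE SWEEP: `P₂ ∘ₖ S ∘ₖ P₁` CONVERGES FROM EVERY START, AT EVERY TIME,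
AND HAS THE GIBBS LAW AS ITS ONLY INVARIANT LAW** — `P₁`, `P₂` ANY Markov kernels leaving
`π = Z⁻¹ w · Haar^{⊗ι}` invariant (over-relaxation sweeps on both sides of the Metropolis sweep; the
`'metro' + n_or × 'or'` chain read at any phase of its cycle): for some `mm` and `ε ∈ (0, 1]`,
`|μ₀ (P₂ ∘ₖ S ∘ₖ P₁)ᵗ(A) − π(A)| ≤ (1 − ε)^{⌊t/(mm+1)⌋}` for EVERY initial law `μ₀`, every `t`, every `A`,
and `π` is the unique invariant probability law. -/
theorem metropolisSweep_twoSided_uniformlyErgodic {a : ℝ≥0∞} (ha : a ≠ 0) {V : Set G}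
    (hV : V ∈ 𝓝 (1 : G)) (hν : a • (haarProbability G).restrict V ≤ ν) (hw : Measurable w) (hm : 0 < m)
    (hwm : ∀ U, m ≤ w U) (hwM : ∀ U, w U ≤ M) {n : ℕ} (hn : 1 ≤ n) {L : List ι} (hL : ∀ j, j ∈ L)
    (P₁ P₂ : Kernel (ι → G) (ι → G)) [IsMarkovKernel P₁] [IsMarkovKernel P₂]
    (hP₁ : Invariant P₁ (gibbsProbability (Measure.pi fun _ : ι => haarProbability G) w))
    (hP₂ : Invariant P₂ (gibbsProbability (Measure.pi fun _ : ι => haarProbability G) w)) :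
    ∃ mm : ℕ, ∃ ε : ℝ, 0 < ε ∧ ε ≤ 1 ∧
      (∀ (μ₀ : Measure (ι → G)) [IsProbabilityMeasure μ₀] (t : ℕ) (A : Set (ι → G)),
        |((fun ν' : Measure (ι → G) => ν'.bind (P₂ ∘ₖ (metropolisSweep ν w n L ∘ₖ P₁)))^[t] μ₀).real A
            - (gibbsProbability (Measure.pi fun _ : ι => haarProbability G) w).real A|
          ≤ (1 - ε) ^ (t / (mm + 1))) ∧
      ∀ (π' : Measure (ι → G)) [IsProbabilityMeasure π'],
        Invariant (P₂ ∘ₖ (metropolisSweep ν w n L ∘ₖ P₁)) π' →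
          π' = gibbsProbability (Measure.pi fun _ : ι => haarProbability G) w := by
  letI : PseudoMetricSpace G := TopologicalSpace.pseudoMetrizableSpacePseudoMetric G
  obtain ⟨V', hV'o, hV'1, κ, hκ, hbox⟩ := metropolisSweep_box_minorised ha hV hν hw hm hwm hwM hn hL
  obtain ⟨r, hr, c, hc, hK, hpos⟩ := spreads_of_box_minorised (ι := ι) hm hwm hwM hV'o hV'1 hκ hbox
  haveI := isProbabilityMeasure_gibbsProbability (μ := Measure.pi fun _ : ι => haarProbability G) hm hwm hwM
  haveI := isMarkovKernel_metropolisSweep ν hw n L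
  have hw0 : ∀ U, 0 < w U := fun U => hm.trans_le (hwm U)
  exact twoSided_uniformlyErgodic (invariant_gibbsProbability (metropolisSweep_invariant ν hw hw0 n L))
    hP₁ hP₂ hr hc hK hpos

end SweepPhase

end Summit.Ventures.LatticeQCDFlow.Exactness
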